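import Literature.NumberTheory.LFunctions.Zhang2022.KnifeEdgeLenZDegreeConjShapes

/-!
# Zhang (2022), rung F-S3 (Landau–Siegel programme, §D edge len = E*-len⁺): route `ZDegreeToeplitzBand`, item α1 —
# CLOSED-FORM ATOMS: the explicit fixed-kernel sesquilinear profile integrals a derived main-term table is a finite sum of
# (same-point, reflected-point, bulk, triangle, integral × endpoint, endpoint × endpoint), their evaluation, kernel
# continuity on the closed domain, pair-homogeneity of every finite sum, and the honest-integral lemma

Y. Zhang, *Discrete mean estimates and the Landau–Siegel zero*, arXiv:2211.02515v1 [Zhang2022LandauSiegel] — an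
unrefereed manuscript under adjudication. **WHAT THIS IS NOT: not a claim about Theorems 1–2 of arXiv:2211.02515, about
Landau–Siegel zeros, or about Parity. The programme SEARCHES and TYPES; no claim about Landau–Siegel zeros, Theorems 1–2
of arXiv:2211.02515 or a repaired Margin232 until a kernel theorem says so.** Vocabulary only: no table of the route is
defined or asserted here; the TYPE of the route's α1 object built on these atoms is `KnifeEdgeLenZDegreeClosedForms`.

* Part 1 — the atom shapes the `KnifeEdgeLenZDegreeKernels` list (p493421: `kernelPair`, `pointPair`, `leftIntegralPoint`,
  `pointRightIntegral`) lacks although Zhang's own form `𝔅` uses them (`MainTermFormPSD.mainTermForm_eq`: `∫|g′|²`,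
  `Im∫g′·conj g`, `∫|g|²` are SAME-POINT integrals, `Im∫g·conj∫g` is a TRIANGLE integral; formula I `Repair.Mform`,
  (8.11)–(8.12)): `localPair`, `antilocalPair` (pairs `y` with `1 − y`: the functional-equation reflection of the dictionary,
  pub-zhang STRUCTURE.md §1 `R̃g(z) = conj g(1−z)`), `volterraPair`, and integral × endpoint with the derivative leg allowed
  (`leftIntegralPoint₂`, `pointRightIntegral₂`). Each is `PairHomogeneous` with NO integrability hypothesis (scalars pull
  out of interval integrals unconditionally). HONEST INTEGRALS (critic ls-knife-crit-1, pin (b″) «no silent-zero integrals»):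
  `intervalIntegrable_localPair_integrand` — kernels `ContinuousOn [0,1]` and KINKED in-class legs (`Repair.KinkedProfile`:
  continuous profile, `L²` right derivative) make the integrand `L¹` (`C⁰·C⁰`, `C⁰·L²`, `L²·L²` via the tree's
  `IsH1OnUnitInterval` bookkeeping), so the interval integral is a value, not Lean's junk `0`; the condition is continuity on
  the CLOSED interval/square per atom (`ClosedFormAtom.KernelsContinuous`) — «continuous on the closed square» for ONE global
  kernel would be too strong even for `𝔅`, whose `∫_y¹`-terms are triangle atoms.
* Part 2 — `ClosedFormAtom` (seven constructors), `ClosedFormAtom.eval : PairFunctional` with its unfolding `simp` set,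
  `ClosedFormAtom.KernelsContinuous`, `ClosedForm := List ClosedFormAtom`, `ClosedForm.eval` (the finite sum),
  `pairHomogeneous_closedForm_eval`, `vanishesOnZero_closedForm_eval`, `pairConjHomogeneous_conjLeft_closedForm_eval`.

* Part 3 (appended 2026-08-27, critic ls-knife-crit-1 g5 pre-registration (P2)): the honest-integral lemmas for the two
  integral × endpoint atoms (`intervalIntegrable_leftIntegralPoint₂_integrand`, `intervalIntegrable_pointRightIntegral₂_integrand`:
  `C⁰·C⁰ + C⁰·L²` on `[0,1]`). Still booked as typed debt (non-blocking per the critic): the reflected atom `antiloc` (needs the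
  `L²` leg transported under `y ↦ 1 − y`) and the two-variable atoms `bulk`/`volt` (need the inner parametric integral continuous in
  the outer variable by dominated convergence).

Typer: ls-knife-typer-1 g6 (cell landau-siegel §D).

## References
* Y. Zhang, arXiv:2211.02515v1 (2022), §2 (2.16)–(2.17), (2.32); §7 Prop. 7.1 (7.2); §8 (8.5), (8.11)–(8.12); §12
  (12.7)–(12.8); §15 Lemma 15.1. [cite: Zhang2022LandauSiegel, §2 (2.16)–(2.17), §7 Prop 7.1 (7.2), §8 (8.5), (8.11)–(8.12)]
-/

noncomputable section

open Complex Real ComplexConjugate Set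

namespace Literature.NumberTheory.LFunctions.Zhang2022.KnifeEdge

open Repair Skeleton

/-! ### Part 1 — the missing atom shapes: same-point, reflected-point, triangle, and integral × endpoint with the derivative leg -/

section Atoms

/-- **LOCAL (same-point) pair:** `∫₀¹ (k₀₀ f·ḡ + k₀₁ f·ḡ′ + k₁₀ f′·ḡ + k₁₁ f′·ḡ′)(y) dy` — the shape of the bulk terms of
Zhang's `𝔅` (`∫|g′|²`, `Im∫g′ḡ`, `∫|g|²`, `mainTermForm_eq`) and of formula I (`Repair.Mform`, (8.11)–(8.12)).
[cite: Zhang2022LandauSiegel, §7 Prop 7.1 (7.2), (8.11)–(8.12)] -/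
def localPair (k₀₀ k₀₁ k₁₀ k₁₁ : ℝ → ℂ) : PairFunctional := fun f f' g g' =>
  ∫ y in (0:ℝ)..1, (k₀₀ y * f y * conj (g y) + k₀₁ y * f y * conj (g' y) +
    k₁₀ y * f' y * conj (g y) + k₁₁ y * f' y * conj (g' y))

/-- **ANTILOCAL (reflected-point) pair:** `∫₀¹ (k₀₀(y) f(y)·ḡ(1−y) + k₀₁ f(y)·ḡ′(1−y) + k₁₀ f′(y)·ḡ(1−y) +
k₁₁ f′(y)·ḡ′(1−y)) dy` — the functional-equation reflection `y ↔ 1 − y` of the dictionary (a root-number unit turns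
`conj Q_g` into a piece with the reflected profile). [cite: Zhang2022LandauSiegel, §2 (2.32), §12 (12.7)–(12.8)] -/
def antilocalPair (k₀₀ k₀₁ k₁₀ k₁₁ : ℝ → ℂ) : PairFunctional := fun f f' g g' =>
  ∫ y in (0:ℝ)..1, (k₀₀ y * f y * conj (g (1 - y)) + k₀₁ y * f y * conj (g' (1 - y)) +
    k₁₀ y * f' y * conj (g (1 - y)) + k₁₁ y * f' y * conj (g' (1 - y)))

/-- **VOLTERRA (triangle) pair:** `∫₀¹ ∫₀ˣ (K₀₀(x,y) f(x)·ḡ(y) + K₀₁ f(x)·ḡ′(y) + K₁₀ f′(x)·ḡ(y) + K₁₁ f′(x)·ḡ′(y)) dy dx`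
— the shape of `𝔅`'s `Im ∫ g·conj(∫₀ʸ g)` and of formula I's `∫ g′·conj(∫_y¹ h)` (the `π²N_j` term of (8.12)).
[cite: Zhang2022LandauSiegel, §7 Prop 7.1 (7.2), (8.12)] -/
def volterraPair (K₀₀ K₀₁ K₁₀ K₁₁ : ℝ → ℝ → ℂ) : PairFunctional := fun f f' g g' =>
  ∫ x in (0:ℝ)..1, ∫ y in (0:ℝ)..x, (K₀₀ x y * f x * conj (g y) + K₀₁ x y * f x * conj (g' y) +
    K₁₀ x y * f' x * conj (g y) + K₁₁ x y * f' x * conj (g' y))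

/-- **Integral × endpoint, both legs of the first piece:** `(∫₀¹ (k₀ f + k₁ f′)(x) dx)·conj g(y₀)` (cf. the `e_j(a)·e_j(b)`
products of formula II, `e_j(g) = g(0⁺) − iπj∫g`, and `Re(conj∫g·(g0+g1))` in `𝔅`). [cite: Zhang2022LandauSiegel, §15 Lemma 15.1, §7 Prop 7.1 (7.2)] -/
def leftIntegralPoint₂ (k₀ k₁ : ℝ → ℂ) (y₀ : ℝ) : PairFunctional := fun f f' g _ =>
  (∫ x in (0:ℝ)..1, (k₀ x * f x + k₁ x * f' x)) * conj (g y₀)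

/-- **Endpoint × integral, both legs of the second piece:** `f(x₀)·conj(∫₀¹ (k₀ g + k₁ g′)(y) dy)`.
[cite: Zhang2022LandauSiegel, §15 Lemma 15.1, §7 Prop 7.1 (7.2)] -/
def pointRightIntegral₂ (x₀ : ℝ) (k₀ k₁ : ℝ → ℂ) : PairFunctional := fun f _ g g' =>
  f x₀ * conj (∫ y in (0:ℝ)..1, (k₀ y * g y + k₁ y * g' y))

/-- `localPair` is pair-homogeneous (no integrability needed). [cite: Zhang2022LandauSiegel, §7 Prop 7.1 (7.2)] -/
theorem pairHomogeneous_localPair (k₀₀ k₀₁ k₁₀ k₁₁ : ℝ → ℂ) : PairHomogeneous (localPair k₀₀ k₀₁ k₁₀ k₁₁) := by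
  refine ⟨fun c a a' b b' => ?_, fun c a a' b b' => ?_⟩
  · simp only [localPair, Pi.smul_apply, smul_eq_mul]
    rw [← intervalIntegral.integral_const_mul]
    refine intervalIntegral.integral_congr fun y _ => ?_
    ring
  · simp only [localPair, Pi.smul_apply, smul_eq_mul, map_mul]
    rw [← intervalIntegral.integral_const_mul]
    refine intervalIntegral.integral_congr fun y _ => ?_
    ring

/-- `antilocalPair` is pair-homogeneous. [cite: Zhang2022LandauSiegel, §7 Prop 7.1 (7.2)] -/
theorem pairHomogeneous_antilocalPair (k₀₀ k₀₁ k₁₀ k₁₁ : ℝ → ℂ) :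
    PairHomogeneous (antilocalPair k₀₀ k₀₁ k₁₀ k₁₁) := by
  refine ⟨fun c a a' b b' => ?_, fun c a a' b b' => ?_⟩
  · simp only [antilocalPair, Pi.smul_apply, smul_eq_mul]
    rw [← intervalIntegral.integral_const_mul]
    refine intervalIntegral.integral_congr fun y _ => ?_
    ring
  · simp only [antilocalPair, Pi.smul_apply, smul_eq_mul, map_mul]
    rw [← intervalIntegral.integral_const_mul]
    refine intervalIntegral.integral_congr fun y _ => ?_
    ring

/-- `volterraPair` is pair-homogeneous. [cite: Zhang2022LandauSiegel, §7 Prop 7.1 (7.2)] -/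
theorem pairHomogeneous_volterraPair (K₀₀ K₀₁ K₁₀ K₁₁ : ℝ → ℝ → ℂ) :
    PairHomogeneous (volterraPair K₀₀ K₀₁ K₁₀ K₁₁) := by
  refine ⟨fun c a a' b b' => ?_, fun c a a' b b' => ?_⟩
  · simp only [volterraPair, Pi.smul_apply, smul_eq_mul]
    rw [← intervalIntegral.integral_const_mul]
    refine intervalIntegral.integral_congr fun x _ => ?_
    rw [← intervalIntegral.integral_const_mul]
    refine intervalIntegral.integral_congr fun y _ => ?_
    ring
  · simp only [volterraPair, Pi.smul_apply, smul_eq_mul, map_mul]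
    rw [← intervalIntegral.integral_const_mul]
    refine intervalIntegral.integral_congr fun x _ => ?_
    rw [← intervalIntegral.integral_const_mul]
    refine intervalIntegral.integral_congr fun y _ => ?_
    ring

/-- `leftIntegralPoint₂` is pair-homogeneous. [cite: Zhang2022LandauSiegel, §7 Prop 7.1 (7.2)] -/
theorem pairHomogeneous_leftIntegralPoint₂ (k₀ k₁ : ℝ → ℂ) (y₀ : ℝ) :
    PairHomogeneous (leftIntegralPoint₂ k₀ k₁ y₀) := by
  refine ⟨fun c a a' b b' => ?_, fun c a a' b b' => ?_⟩
  · simp only [leftIntegralPoint₂, Pi.smul_apply, smul_eq_mul]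
    rw [show (fun x => k₀ x * (c * a x) + k₁ x * (c * a' x)) = fun x => c * (k₀ x * a x + k₁ x * a' x) by
        funext x; ring,
      intervalIntegral.integral_const_mul]
    ring
  · simp only [leftIntegralPoint₂, Pi.smul_apply, smul_eq_mul, map_mul]
    ring

/-- `pointRightIntegral₂` is pair-homogeneous. [cite: Zhang2022LandauSiegel, §7 Prop 7.1 (7.2)] -/
theorem pairHomogeneous_pointRightIntegral₂ (x₀ : ℝ) (k₀ k₁ : ℝ → ℂ) :
    PairHomogeneous (pointRightIntegral₂ x₀ k₀ k₁) := by
  refine ⟨fun c a a' b b' => ?_, fun c a a' b b' => ?_⟩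
  · simp only [pointRightIntegral₂, Pi.smul_apply, smul_eq_mul]
    ring
  · simp only [pointRightIntegral₂, Pi.smul_apply, smul_eq_mul]
    rw [show (fun y => k₀ y * (c * b y) + k₁ y * (c * b' y)) = fun y => c * (k₀ y * b y + k₁ y * b' y) by
        funext y; ring,
      intervalIntegral.integral_const_mul, map_mul]
    ring

/-- **Honest integral (pin (b″)) for the same-point atom:** with kernels continuous on `[0,1]` and KINKED in-class legs
(`Repair.KinkedProfile`: continuous profile, `L²` right derivative) the integrand of `localPair` is integrable on `[0,1]`
(`C⁰·C⁰`, `C⁰·L²`, `L²·L²` products via the tree's `IsH1OnUnitInterval` bookkeeping) — so the interval integral is a genuine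
value, not Lean's junk `0`. The other atoms are the same bookkeeping (reflection `y ↦ 1−y`, an inner parametric integral).
[cite: Zhang2022LandauSiegel, §7 Prop 7.1 (7.2), (8.11)–(8.12)] -/
theorem intervalIntegrable_localPair_integrand {k₀₀ k₀₁ k₁₀ k₁₁ : ℝ → ℂ} (h₀₀ : ContinuousOn k₀₀ (Icc 0 1))
    (h₀₁ : ContinuousOn k₀₁ (Icc 0 1)) (h₁₀ : ContinuousOn k₁₀ (Icc 0 1)) (h₁₁ : ContinuousOn k₁₁ (Icc 0 1))
    {f f' g g' : ℝ → ℂ} (hf : KinkedProfile f f') (hg : KinkedProfile g g') :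
    IntervalIntegrable (fun y => k₀₀ y * f y * conj (g y) + k₀₁ y * f y * conj (g' y) +
      k₁₀ y * f' y * conj (g y) + k₁₁ y * f' y * conj (g' y)) MeasureTheory.volume 0 1 := by
  have hF := hf.isH1
  have hG := hg.isH1
  have hI : uIcc (0:ℝ) 1 = Icc 0 1 := uIcc_of_le zero_le_one
  have e₀₀ : IntervalIntegrable (fun y => k₀₀ y * (f y * conj (g y))) MeasureTheory.volume 0 1 :=
    (hF.intervalIntegrable_mul_conj hG).continuousOn_mul (by rw [hI]; exact h₀₀)
  have e₀₁ : IntervalIntegrable (fun y => k₀₁ y * (conj (g' y) * f y)) MeasureTheory.volume 0 1 := by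
    refine IntervalIntegrable.continuousOn_mul ?_ (by rw [hI]; exact h₀₁)
    have := (hG.intervalIntegrable_deriv_mul_conj hF)
    -- `g′ · conj f` integrable ⇒ its conjugate `conj g′ · f` integrable
    have hc : IntervalIntegrable (fun y => conj (g' y * conj (f y))) MeasureTheory.volume 0 1 := by
      rw [intervalIntegrable_iff] at this ⊢
      exact (Complex.conjLIE.toContinuousLinearMap.integrable_comp this : _)
    refine hc.congr ?_
    intro y _
    simp [map_mul]
  have e₁₀ : IntervalIntegrable (fun y => k₁₀ y * (f' y * conj (g y))) MeasureTheory.volume 0 1 :=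
    (hF.intervalIntegrable_deriv_mul_conj hG).continuousOn_mul (by rw [hI]; exact h₁₀)
  have e₁₁ : IntervalIntegrable (fun y => k₁₁ y * (f' y * conj (g' y))) MeasureTheory.volume 0 1 :=
    (hF.intervalIntegrable_deriv_mul_conj_deriv hG).continuousOn_mul (by rw [hI]; exact h₁₁)
  have hsum := ((e₀₀.add e₀₁).add e₁₀).add e₁₁
  refine hsum.congr ?_
  intro y _
  simp only
  ring

end Atoms

/-! ### Part 2 — closed-form ATOMS, their evaluation, kernel continuity, finite sums -/

section ClosedForms

/-- **A closed-form atom** — one explicit sesquilinear profile integral with FIXED kernels (no case analysis on the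
profile, no choice): same-point, reflected-point, bulk double integral, triangle, integral × endpoint, endpoint × integral,
endpoint × endpoint. The derivation's output (K1″a) is a finite list of these per table. [cite: Zhang2022LandauSiegel, §7 Prop 7.1 (7.2), §8 (8.5)] -/
inductive ClosedFormAtom : Type
  /-- `∫₀¹ (k₀₀ f ḡ + k₀₁ f ḡ′ + k₁₀ f′ ḡ + k₁₁ f′ ḡ′)(y) dy` -/
  | loc (k₀₀ k₀₁ k₁₀ k₁₁ : ℝ → ℂ)
  /-- `∫₀¹ (k₀₀(y) f(y) ḡ(1−y) + …) dy` -/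
  | antiloc (k₀₀ k₀₁ k₁₀ k₁₁ : ℝ → ℂ)
  /-- `∫₀¹∫₀¹ (K₀₀(x,y) f(x) ḡ(y) + …) dy dx` (`kernelPair 1 1`) -/
  | bulk (K₀₀ K₀₁ K₁₀ K₁₁ : ℝ → ℝ → ℂ)
  /-- `∫₀¹∫₀ˣ (K₀₀(x,y) f(x) ḡ(y) + …) dy dx` -/
  | volt (K₀₀ K₀₁ K₁₀ K₁₁ : ℝ → ℝ → ℂ)
  /-- `(∫₀¹ (k₀ f + k₁ f′)) · ḡ(y₀)` -/
  | intPt (k₀ k₁ : ℝ → ℂ) (y₀ : ℝ)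
  /-- `f(x₀) · conj ∫₀¹ (k₀ g + k₁ g′)` -/
  | ptInt (x₀ : ℝ) (k₀ k₁ : ℝ → ℂ)
  /-- `w · f(x₀) · ḡ(y₀)` (`pointPair`) -/
  | ptPt (w : ℂ) (x₀ y₀ : ℝ)

namespace ClosedFormAtom

/-- The pair functional an atom denotes (linear in the first piece `(f,f′)`, conjugate-linear in the second `(g,g′)`).
[cite: Zhang2022LandauSiegel, §7 Prop 7.1 (7.2)] -/
def eval : ClosedFormAtom → PairFunctional
  | loc k₀₀ k₀₁ k₁₀ k₁₁ => localPair k₀₀ k₀₁ k₁₀ k₁₁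
  | antiloc k₀₀ k₀₁ k₁₀ k₁₁ => antilocalPair k₀₀ k₀₁ k₁₀ k₁₁
  | bulk K₀₀ K₀₁ K₁₀ K₁₁ => kernelPair 1 1 K₀₀ K₀₁ K₁₀ K₁₁
  | volt K₀₀ K₀₁ K₁₀ K₁₁ => volterraPair K₀₀ K₀₁ K₁₀ K₁₁
  | intPt k₀ k₁ y₀ => leftIntegralPoint₂ k₀ k₁ y₀
  | ptInt x₀ k₀ k₁ => pointRightIntegral₂ x₀ k₀ k₁
  | ptPt w x₀ y₀ => pointPair w x₀ y₀

/-- unfolding: `(loc …).eval`. [cite: Zhang2022LandauSiegel, §7 Prop 7.1 (7.2)] -/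
@[simp] theorem eval_loc (k₀₀ k₀₁ k₁₀ k₁₁ : ℝ → ℂ) : (loc k₀₀ k₀₁ k₁₀ k₁₁).eval = localPair k₀₀ k₀₁ k₁₀ k₁₁ := rfl

/-- unfolding: `(antiloc …).eval`. [cite: Zhang2022LandauSiegel, §7 Prop 7.1 (7.2)] -/
@[simp] theorem eval_antiloc (k₀₀ k₀₁ k₁₀ k₁₁ : ℝ → ℂ) :
    (antiloc k₀₀ k₀₁ k₁₀ k₁₁).eval = antilocalPair k₀₀ k₀₁ k₁₀ k₁₁ := rfl

/-- unfolding: `(bulk …).eval`. [cite: Zhang2022LandauSiegel, §7 Prop 7.1 (7.2)] -/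
@[simp] theorem eval_bulk (K₀₀ K₀₁ K₁₀ K₁₁ : ℝ → ℝ → ℂ) : (bulk K₀₀ K₀₁ K₁₀ K₁₁).eval = kernelPair 1 1 K₀₀ K₀₁ K₁₀ K₁₁ := rfl

/-- unfolding: `(volt …).eval`. [cite: Zhang2022LandauSiegel, §7 Prop 7.1 (7.2)] -/
@[simp] theorem eval_volt (K₀₀ K₀₁ K₁₀ K₁₁ : ℝ → ℝ → ℂ) : (volt K₀₀ K₀₁ K₁₀ K₁₁).eval = volterraPair K₀₀ K₀₁ K₁₀ K₁₁ := rfl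

/-- unfolding: `(intPt …).eval`. [cite: Zhang2022LandauSiegel, §7 Prop 7.1 (7.2)] -/
@[simp] theorem eval_intPt (k₀ k₁ : ℝ → ℂ) (y₀ : ℝ) : (intPt k₀ k₁ y₀).eval = leftIntegralPoint₂ k₀ k₁ y₀ := rfl

/-- unfolding: `(ptInt …).eval`. [cite: Zhang2022LandauSiegel, §7 Prop 7.1 (7.2)] -/
@[simp] theorem eval_ptInt (x₀ : ℝ) (k₀ k₁ : ℝ → ℂ) : (ptInt x₀ k₀ k₁).eval = pointRightIntegral₂ x₀ k₀ k₁ := rfl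

/-- unfolding: `(ptPt …).eval`. [cite: Zhang2022LandauSiegel, §7 Prop 7.1 (7.2)] -/
@[simp] theorem eval_ptPt (w : ℂ) (x₀ y₀ : ℝ) : (ptPt w x₀ y₀).eval = pointPair w x₀ y₀ := rfl

/-- **Kernel continuity on the CLOSED domain** (critic's pin (b″), no silent-zero integrals): one-variable kernels
`ContinuousOn` `[0,1]`, two-variable kernels `ContinuousOn` `[0,1]²`, marked points inside `[0,1]`.
[cite: Zhang2022LandauSiegel, §7 Prop 7.1 (7.2)] -/
def KernelsContinuous : ClosedFormAtom → Prop
  | loc k₀₀ k₀₁ k₁₀ k₁₁ => ContinuousOn k₀₀ (Icc 0 1) ∧ ContinuousOn k₀₁ (Icc 0 1) ∧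
      ContinuousOn k₁₀ (Icc 0 1) ∧ ContinuousOn k₁₁ (Icc 0 1)
  | antiloc k₀₀ k₀₁ k₁₀ k₁₁ => ContinuousOn k₀₀ (Icc 0 1) ∧ ContinuousOn k₀₁ (Icc 0 1) ∧
      ContinuousOn k₁₀ (Icc 0 1) ∧ ContinuousOn k₁₁ (Icc 0 1)
  | bulk K₀₀ K₀₁ K₁₀ K₁₁ => ContinuousOn (Function.uncurry K₀₀) (Icc 0 1 ×ˢ Icc 0 1) ∧
      ContinuousOn (Function.uncurry K₀₁) (Icc 0 1 ×ˢ Icc 0 1) ∧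
      ContinuousOn (Function.uncurry K₁₀) (Icc 0 1 ×ˢ Icc 0 1) ∧ ContinuousOn (Function.uncurry K₁₁) (Icc 0 1 ×ˢ Icc 0 1)
  | volt K₀₀ K₀₁ K₁₀ K₁₁ => ContinuousOn (Function.uncurry K₀₀) (Icc 0 1 ×ˢ Icc 0 1) ∧
      ContinuousOn (Function.uncurry K₀₁) (Icc 0 1 ×ˢ Icc 0 1) ∧
      ContinuousOn (Function.uncurry K₁₀) (Icc 0 1 ×ˢ Icc 0 1) ∧ ContinuousOn (Function.uncurry K₁₁) (Icc 0 1 ×ˢ Icc 0 1)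
  | intPt k₀ k₁ y₀ => ContinuousOn k₀ (Icc 0 1) ∧ ContinuousOn k₁ (Icc 0 1) ∧ y₀ ∈ Icc (0:ℝ) 1
  | ptInt x₀ k₀ k₁ => x₀ ∈ Icc (0:ℝ) 1 ∧ ContinuousOn k₀ (Icc 0 1) ∧ ContinuousOn k₁ (Icc 0 1)
  | ptPt _ x₀ y₀ => x₀ ∈ Icc (0:ℝ) 1 ∧ y₀ ∈ Icc (0:ℝ) 1

/-- Every atom is pair-homogeneous. [cite: Zhang2022LandauSiegel, §7 Prop 7.1 (7.2)] -/
theorem pairHomogeneous_eval : ∀ a : ClosedFormAtom, PairHomogeneous a.eval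
  | loc k₀₀ k₀₁ k₁₀ k₁₁ => pairHomogeneous_localPair k₀₀ k₀₁ k₁₀ k₁₁
  | antiloc k₀₀ k₀₁ k₁₀ k₁₁ => pairHomogeneous_antilocalPair k₀₀ k₀₁ k₁₀ k₁₁
  | bulk K₀₀ K₀₁ K₁₀ K₁₁ => pairHomogeneous_kernelPair 1 1 K₀₀ K₀₁ K₁₀ K₁₁
  | volt K₀₀ K₀₁ K₁₀ K₁₁ => pairHomogeneous_volterraPair K₀₀ K₀₁ K₁₀ K₁₁
  | intPt k₀ k₁ y₀ => pairHomogeneous_leftIntegralPoint₂ k₀ k₁ y₀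
  | ptInt x₀ k₀ k₁ => pairHomogeneous_pointRightIntegral₂ x₀ k₀ k₁
  | ptPt w x₀ y₀ => pairHomogeneous_pointPair w x₀ y₀

end ClosedFormAtom

/-- **A closed form** — a finite list of atoms (its value is their sum). [cite: Zhang2022LandauSiegel, §7 Prop 7.1 (7.2)] -/
abbrev ClosedForm : Type := List ClosedFormAtom

/-- The pair functional of a closed form: the sum of its atoms. [cite: Zhang2022LandauSiegel, §7 Prop 7.1 (7.2)] -/
def ClosedForm.eval : ClosedForm → PairFunctional
  | [] => 0
  | a :: L => a.eval + ClosedForm.eval L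

/-- All kernels of a closed form are continuous on the closed domain. [cite: Zhang2022LandauSiegel, §7 Prop 7.1 (7.2)] -/
def ClosedForm.KernelsContinuous (L : ClosedForm) : Prop := ∀ a ∈ L, a.KernelsContinuous

/-- `eval [] = 0`. [cite: Zhang2022LandauSiegel, §7 Prop 7.1 (7.2)] -/
@[simp] theorem ClosedForm.eval_nil : ClosedForm.eval [] = 0 := rfl

/-- `eval (a :: L) = a.eval + eval L`. [cite: Zhang2022LandauSiegel, §7 Prop 7.1 (7.2)] -/
@[simp] theorem ClosedForm.eval_cons (a : ClosedFormAtom) (L : ClosedForm) :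
    ClosedForm.eval (a :: L) = a.eval + ClosedForm.eval L := rfl

/-- **Every closed form is pair-homogeneous** (so it passes the α1 junk guard, `vanishesOnZero_of_pairHomogeneous`, and
cannot be the critic's junk table `Xj`, `not_pairHomogeneous_Xj`). [cite: Zhang2022LandauSiegel, §7 Prop 7.1 (7.2)] -/
theorem pairHomogeneous_closedForm_eval : ∀ L : ClosedForm, PairHomogeneous (ClosedForm.eval L)
  | [] => pairHomogeneous_zero
  | a :: L => by
    rw [ClosedForm.eval_cons]
    exact (ClosedFormAtom.pairHomogeneous_eval a).add (pairHomogeneous_closedForm_eval L)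

/-- … hence guarded. [cite: Zhang2022LandauSiegel, §7 Prop 7.1 (7.2)] -/
theorem vanishesOnZero_closedForm_eval (L : ClosedForm) : VanishesOnZero (ClosedForm.eval L) :=
  vanishesOnZero_of_pairHomogeneous (pairHomogeneous_closedForm_eval L)

/-- … and its leg-0 conjugate is conjugate pair-homogeneous (the cross-slot variance). [cite: Zhang2022LandauSiegel, §8 (8.5)] -/
theorem pairConjHomogeneous_conjLeft_closedForm_eval (L : ClosedForm) : PairConjHomogeneous (conjLeft (ClosedForm.eval L)) :=
  pairConjHomogeneous_conjLeft (pairHomogeneous_closedForm_eval L)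

end ClosedForms

/-! ### Part 3 — honest integrals for the integral × endpoint atoms (pin (b″), critic's (P2)) -/

section HonestEdge

/-- **Honest integral for `leftIntegralPoint₂` / atom `intPt`:** with `k₀, k₁` continuous on `[0,1]` and a kinked first piece
(`Repair.KinkedProfile f f′`) the integrand `k₀ f + k₁ f′` is integrable on `[0,1]` (`C⁰·C⁰` and `C⁰·L²`), so
`∫₀¹ (k₀ f + k₁ f′)` is a value, not Lean's junk `0`. [cite: Zhang2022LandauSiegel, §7 Prop 7.1 (7.2)] -/
theorem intervalIntegrable_leftIntegralPoint₂_integrand {k₀ k₁ : ℝ → ℂ} (h₀ : ContinuousOn k₀ (Icc 0 1))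
    (h₁ : ContinuousOn k₁ (Icc 0 1)) {f f' : ℝ → ℂ} (hf : KinkedProfile f f') :
    IntervalIntegrable (fun x => k₀ x * f x + k₁ x * f' x) MeasureTheory.volume 0 1 := by
  have hF := hf.isH1
  have hI : uIcc (0:ℝ) 1 = Icc 0 1 := uIcc_of_le zero_le_one
  have e₀ : IntervalIntegrable (fun x => k₀ x * f x) MeasureTheory.volume 0 1 :=
    (h₀.mul hF.continuousOn).intervalIntegrable_of_Icc zero_le_one
  have e₁ : IntervalIntegrable (fun x => k₁ x * f' x) MeasureTheory.volume 0 1 :=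
    hF.intervalIntegrable.continuousOn_mul (by rw [hI]; exact h₁)
  exact e₀.add e₁

/-- **Honest integral for `pointRightIntegral₂` / atom `ptInt`:** the same for the second piece, `∫₀¹ (k₀ g + k₁ g′)`.
[cite: Zhang2022LandauSiegel, §7 Prop 7.1 (7.2)] -/
theorem intervalIntegrable_pointRightIntegral₂_integrand {k₀ k₁ : ℝ → ℂ} (h₀ : ContinuousOn k₀ (Icc 0 1))
    (h₁ : ContinuousOn k₁ (Icc 0 1)) {g g' : ℝ → ℂ} (hg : KinkedProfile g g') :
    IntervalIntegrable (fun y => k₀ y * g y + k₁ y * g' y) MeasureTheory.volume 0 1 :=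
  intervalIntegrable_leftIntegralPoint₂_integrand h₀ h₁ hg

/-- With an honest integrand the `intPt` atom is literally «(a genuine integral) × (an endpoint value)»: its value on kinked
legs unfolds with no side condition left. [cite: Zhang2022LandauSiegel, §7 Prop 7.1 (7.2)] -/
theorem ClosedFormAtom.eval_intPt_apply (k₀ k₁ : ℝ → ℂ) (y₀ : ℝ) (f f' g g' : ℝ → ℂ) :
    (ClosedFormAtom.intPt k₀ k₁ y₀).eval f f' g g' = (∫ x in (0:ℝ)..1, (k₀ x * f x + k₁ x * f' x)) * conj (g y₀) := rfl

/-- … and the `ptInt` atom. [cite: Zhang2022LandauSiegel, §7 Prop 7.1 (7.2)] -/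
theorem ClosedFormAtom.eval_ptInt_apply (x₀ : ℝ) (k₀ k₁ : ℝ → ℂ) (f f' g g' : ℝ → ℂ) :
    (ClosedFormAtom.ptInt x₀ k₀ k₁).eval f f' g g' = f x₀ * conj (∫ y in (0:ℝ)..1, (k₀ y * g y + k₁ y * g' y)) := rfl

end HonestEdge

end Literature.NumberTheory.LFunctions.Zhang2022.KnifeEdge

end
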